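import Literature.Computability.Complexity.ExtMonotoneCliqueGate
import Mathlib.Logic.Equiv.Fin.Rotate
import Mathlib.Algebra.Group.End
import Mathlib.Algebra.Group.Subgroup.Map
import Mathlib.Algebra.Group.Submonoid.BigOperators
import Mathlib.Data.ZMod.Basic
import Mathlib.Algebra.CharP.Two

/-!
# `CliqueExtLowerBound` (stmt-PneNP-10682, route PneNP/ConvexRankGates) — negative-side lemmas: PERM universality

Standing-adversary (cdisprove, gen 2) output for the crux
`Summit.PneNP.PneNP.Theses.ConvexRankGates.CliqueExtLowerBound` (no `m^c`-size circuit over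
`B_{m^c} = {∧₂, ∨₂} ∪ CONV_{m^c} ∪ PERM_{m^c} ∪ GRANK_{m^c}` computes `CLIQUE(m, ⌈m^δ⌉₊)`), PERM part.
The PERM gates of the route (`IsPermGate s`: fixed permutations `σᵢ, τ` of `≤ s` points, accept `v` iff
`τ ∈ ⟨σᵢ : vᵢ = 1⟩`) were advertised as "abelian case = monotone span programs over ℤ/q". Proved here:

* `spanGate_isPermGate` — **every monotone span program over 𝔽₂ whose rows are owned by WIRES is ONE
  PERM gate on `2 · dim` points**: realise `(𝔽₂^κ, +)` inside `Sym(ZMod 2 × κ)` by the translations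
  `(c, p) ↦ (c + w p, p)` (`flipHom`, an injective hom), so that "target in the 𝔽₂-span of the selected
  rows" is "τ in the subgroup generated by the selected σᵢ" (`MonoidHom.map_closure`). Because a circuit
  may wire several argument positions of one gate to the same variable, a variable may own MANY rows —
  exactly Karchmer–Wigderson monotone span programs; so `PERM_s ⊇ MSP_{𝔽₂}` of dimension `s/2`.
* `tgt_mem_closure_iff`, `exists_onePermGate_computes` — **CLIQUE(m, k), `k ≥ 2`, is ONE PERM gate**:
  the CYCLE span program (coordinates `⋆ ⊔ wires`, wires = (k-set `T`, edge of `T`); the rows of `T` are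
  the 𝔽₂-incidence vectors of one cycle through the edges of `T` with the target `e_⋆` hung on the edge
  of index 0: completeness = the cycle sums to `e_⋆`, soundness = an explicit killing functional
  `φ_c(f) = f_⋆ + ∑ c_w f_w` vanishing on every selected row when each `T` has an unselected edge).
* `permWidth_le`, `permWidth_le_of_choose_le` — the gate lives on `permWidth m k ≤ 2(1 + C(m,k)·#E)`
  points, `≤ m^{j+3}` as soon as `C(m,k) ≤ m^j` (`m ≥ 3`); `exists_onePermGate_extGate_computes`.

Consequences (companion `LoadBearing.lean`, crux work file `Cruxes/CliqueExtLowerBound/Disproof.lean`):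
the PERM dimension bound `d ≤ s` is load-bearing like the CONV width bound, and every schedule with
`C(m, k m) ≤ m^j` is refuted over the sub-basis of crux #4 `LinAlgGateBlind` too. PERM companion of
`ExtMonotoneCliqueGate.lean` (CONV: one LP gate) and `ExtMonotoneGRankSupport.lean` (GRANK).

References: Karchmer–Wigderson, *On span programs* (1993) — rows labelled by variables, with repetition;
Furst–Hopcroft–Luks (1980) — PERM gates are P-evaluable, so none of this threatens NP ⊄ P/poly.
Refuter seat cdisprove-stmt-PneNP-10682-g2, 2026-08-15.
-/

namespace Summit.PneNP.PneNP.Theorems.CliqueExtLowerBound.Negative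

open Literature.Computability.Complexity Literature.Computability.Complexity.CliqueLPGate Finset

/-! ### 1. Translations of `ZMod 2 × κ` realise `(κ → ZMod 2, +)` inside `Sym(2·#κ)` -/

section Flip

variable {κ : Type*}

/-- Translation by `w` in the first coordinate: `(c, p) ↦ (c + w p, p)`. [folklore] -/
def flipAux (w : κ → ZMod 2) : Equiv.Perm (ZMod 2 × κ) where
  toFun p := (p.1 + w p.2, p.2)
  invFun p := (p.1 - w p.2, p.2)
  left_inv p := by simp
  right_inv p := by simp

/-- `flipAux` on points. [folklore] -/
@[simp] theorem flipAux_apply (w : κ → ZMod 2) (p : ZMod 2 × κ) :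
    flipAux w p = (p.1 + w p.2, p.2) := rfl

/-- `flipAux` is additive-to-multiplicative. [folklore] -/
theorem flipAux_add (w w' : κ → ZMod 2) : flipAux (w + w') = flipAux w * flipAux w' := by
  ext p : 1; simp only [Equiv.Perm.mul_apply, flipAux_apply, Pi.add_apply, Prod.mk.injEq, and_true]; ring

/-- `w ↦ flipAux w` as a monoid hom out of `Multiplicative (κ → ZMod 2)`. [folklore] -/
def flipHomAux : Multiplicative (κ → ZMod 2) →* Equiv.Perm (ZMod 2 × κ) where
  toFun w := flipAux (Multiplicative.toAdd w)
  map_one' := by ext p : 1; simp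
  map_mul' a b := by
    show flipAux (Multiplicative.toAdd (a * b)) = _
    rw [toAdd_mul, flipAux_add]

/-- `flipHomAux` is injective (read `w p` off the image of `(0, p)`). [folklore] -/
theorem flipHomAux_injective : Function.Injective (flipHomAux (κ := κ)) := by
  intro a b h
  have key : ∀ p, Multiplicative.toAdd a p = Multiplicative.toAdd b p := fun p => by
    have := congrArg (fun σ : Equiv.Perm (ZMod 2 × κ) => (σ (0, p)).1) h
    simpa [flipHomAux] using this
  exact Multiplicative.toAdd.injective (funext key)

variable [Fintype κ]

/-- The same, transported to permutations of `Fin (#(ZMod 2 × κ))` (the PERM gate format). [folklore] -/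
noncomputable def flipHom : Multiplicative (κ → ZMod 2) →* Equiv.Perm (Fin (Fintype.card (ZMod 2 × κ))) :=
  (Equiv.permCongrHom (Fintype.equivFin (ZMod 2 × κ))).toMonoidHom.comp flipHomAux

/-- `flipHom` is injective. [folklore] -/
theorem flipHom_injective : Function.Injective (flipHom (κ := κ)) :=
  (Equiv.permCongrHom (Fintype.equivFin (ZMod 2 × κ))).injective.comp flipHomAux_injective

/-- **Every 𝔽₂ span program whose rows are owned by wires is ONE PERM gate on `2·dim` points.** Rows
`ρ i ∈ 𝔽₂^κ` (one per WIRE `i` — in a circuit several wires may read the same variable, so a variable may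
own many rows, exactly as in Karchmer–Wigderson span programs), target `t`; the gate accepts `v` iff `t`
lies in the span (= subgroup generated, over 𝔽₂) of the rows of the wires that are on. It is the PERM gate
with `σ i =` translation by `ρ i` and `τ =` translation by `t` on the point set `ZMod 2 × κ`. [folklore] -/
theorem spanGate_isPermGate {n : ℕ} (ρ : Fin n → κ → ZMod 2) (t : κ → ZMod 2)
    (f : (Fin n → Bool) → Bool)
    (hf : ∀ v, f v = true ↔ Multiplicative.ofAdd t ∈
      Subgroup.closure ((fun i => Multiplicative.ofAdd (ρ i)) '' {i | v i = true})) :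
    IsPermGate (Fintype.card (ZMod 2 × κ)) ⟨n, f⟩ := by
  refine ⟨_, le_rfl, fun i => flipHom (Multiplicative.ofAdd (ρ i)), flipHom (Multiplicative.ofAdd t),
    fun v => ?_⟩
  show f v = true ↔ _
  rw [hf v]
  have himg : (fun i : Fin n => flipHom (Multiplicative.ofAdd (ρ i))) '' {i | v i = true} =
      flipHom '' ((fun i => Multiplicative.ofAdd (ρ i)) '' {i | v i = true}) :=
    (Set.image_image _ _ _).symm
  rw [himg, ← MonoidHom.map_closure, Subgroup.mem_map_iff_mem flipHom_injective]

/-- Width bookkeeping: `#(ZMod 2 × κ) = 2·#κ`. [folklore] -/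
theorem card_zmod_two_prod : Fintype.card (ZMod 2 × κ) = 2 * Fintype.card κ := by
  rw [Fintype.card_prod, ZMod.card]

end Flip

/-! ### 2. The cycle span program for CLIQUE(m, k) -/

section CliqueSpan

variable (m k : ℕ)

/-- Edges of `K_m` inside the `k`-set `T`. [folklore] -/
abbrev ET (T : KSub m k) : Type := {e : (⊤ : SimpleGraph (Fin m)).edgeSet // ∀ y ∈ (e : Sym2 (Fin m)), y ∈ T.1}

/-- Their number (`= C(k,2)`; only `≤ #E` is used). [folklore] -/
noncomputable def L (T : KSub m k) : ℕ := Fintype.card (ET m k T)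

/-- An enumeration of the edges inside `T`. [folklore] -/
noncomputable def enumET (T : KSub m k) : ET m k T ≃ Fin (L m k T) := Fintype.equivFin _

/-- Wires of the span program: (a `k`-set, the index of one of its edges). [folklore] -/
abbrev W : Type := Σ T : KSub m k, Fin (L m k T)

/-- The edge variable read by a wire. [folklore] -/
noncomputable def wedge (w : W m k) : (⊤ : SimpleGraph (Fin m)).edgeSet := ((enumET m k w.1).symm w.2).1

variable {m k}

/-- Cyclic successor on `Fin n`. [folklore] -/
def nxt {n : ℕ} (j : Fin n) : Fin n := ⟨(j.1 + 1) % n, Nat.mod_lt _ j.pos⟩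

/-- `finRotate n j = (j + 1) % n` on values. [folklore] -/
theorem val_finRotate {n : ℕ} (j : Fin n) : ((finRotate n j : Fin n) : ℕ) = (j.1 + 1) % n := by
  cases n with
  | zero => exact j.elim0
  | succ n =>
    rw [coe_finRotate]
    split_ifs with h
    · subst h; simp
    · have : (j : ℕ) < n := Fin.val_lt_last h
      rw [Nat.mod_eq_of_lt (by omega)]

/-- `nxt` is `finRotate`. [folklore] -/
theorem nxt_eq_finRotate {n : ℕ} (j : Fin n) : nxt j = finRotate n j :=
  Fin.ext (by rw [val_finRotate]; rfl)

variable (m k)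

/-- Rows: wire `(T, j)` owns `e_{(T,j)} + e_{(T, j+1 mod L)} + [j = 0]·e_⋆` in `𝔽₂^{⋆ ⊔ W}` — the incidence
vectors of ONE cycle through the edges of `T`, with the target coordinate `⋆` hung on the edge of index 0.
[folklore] -/
noncomputable def row (w : W m k) : Option (W m k) → ZMod 2 :=
  Pi.single (some w) 1 + Pi.single (some ⟨w.1, nxt w.2⟩) 1 +
    if (w.2 : ℕ) = 0 then Pi.single none 1 else 0

/-- Target: `e_⋆`. [folklore] -/
noncomputable def tgt : Option (W m k) → ZMod 2 := Pi.single none 1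

variable {m k}

/-- COMPLETENESS of the cycle program: the rows of one `k`-set sum to the target. [folklore] -/
theorem sum_row_eq_tgt (T : KSub m k) (hL : 0 < L m k T) :
    ∑ j : Fin (L m k T), row m k ⟨T, j⟩ = tgt m k := by
  have h1 : ∑ j : Fin (L m k T), (Pi.single (some (⟨T, nxt j⟩ : W m k)) (1 : ZMod 2) :
      Option (W m k) → ZMod 2) =
      ∑ j : Fin (L m k T), Pi.single (some (⟨T, j⟩ : W m k)) 1 := by
    simp only [nxt_eq_finRotate]
    exact Equiv.sum_comp (finRotate (L m k T))
      (fun j => (Pi.single (some (⟨T, j⟩ : W m k)) (1 : ZMod 2) : Option (W m k) → ZMod 2))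
  have h2 : ∑ j : Fin (L m k T), (if ((j : ℕ) = 0) then (Pi.single none (1 : ZMod 2) :
      Option (W m k) → ZMod 2) else 0) = tgt m k := by
    rw [Finset.sum_ite, Finset.sum_const_zero, add_zero, Finset.sum_const]
    have : (univ.filter fun j : Fin (L m k T) => (j : ℕ) = 0) = {⟨0, hL⟩} := by
      ext j
      simp only [Finset.mem_filter, Finset.mem_univ, true_and, Finset.mem_singleton, Fin.ext_iff]
    rw [this, Finset.card_singleton, one_smul]
    rfl
  simp only [row, Finset.sum_add_distrib, h1, h2]
  have h3 : ∀ f : Option (W m k) → ZMod 2, f + f = 0 := fun f =>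
    funext fun a => CharTwo.add_self_eq_zero (f a)
  rw [h3, zero_add]

/-- The killing functional: `φ_c(f) = f ⋆ + ∑_w c_w f_w`. [folklore] -/
noncomputable def phi (c : W m k → ZMod 2) : (Option (W m k) → ZMod 2) →+ ZMod 2 where
  toFun f := f none + ∑ w, c w * f (some w)
  map_zero' := by simp
  map_add' f g := by
    simp only [Pi.add_apply, mul_add, Finset.sum_add_distrib]
    ring

/-- `φ_c(e_⋆) = 1`. [folklore] -/
theorem phi_single_none (c : W m k → ZMod 2) : phi c (Pi.single none 1) = 1 := by
  simp [phi]

/-- `φ_c(e_w) = c_w`. [folklore] -/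
theorem phi_single_some (c : W m k → ZMod 2) (w : W m k) : phi c (Pi.single (some w) 1) = c w := by
  classical
  simp only [phi, AddMonoidHom.coe_mk, ZeroHom.coe_mk]
  rw [Pi.single_eq_of_ne (Option.some_ne_none w).symm, zero_add]
  rw [Finset.sum_eq_single w]
  · simp
  · intro w' _ hne
    rw [Pi.single_eq_of_ne (fun h => hne (Option.some_injective _ h)), mul_zero]
  · intro h; exact absurd (Finset.mem_univ w) h

/-- `φ_c` on a row. [folklore] -/
theorem phi_row (c : W m k → ZMod 2) (T : KSub m k) (j : Fin (L m k T)) :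
    phi c (row m k ⟨T, j⟩) = c ⟨T, j⟩ + c ⟨T, nxt j⟩ + if (j : ℕ) = 0 then 1 else 0 := by
  simp only [row, map_add, phi_single_some]
  split_ifs
  · rw [phi_single_none]
  · rw [map_zero]

/-- SOUNDNESS arithmetic: with `c_{(T,i)} = [1 ≤ i ≤ j_T]`, every row of `T` other than `j_T` is killed.
[folklore] -/
theorem kill_arith {Lt : ℕ} (j jT : Fin Lt) (hne : j ≠ jT) :
    ((if 1 ≤ (j : ℕ) ∧ (j : ℕ) ≤ jT then (1 : ZMod 2) else 0) +
      (if 1 ≤ ((nxt j : Fin Lt) : ℕ) ∧ ((nxt j : Fin Lt) : ℕ) ≤ jT then (1 : ZMod 2) else 0) +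
      if (j : ℕ) = 0 then (1 : ZMod 2) else 0) = 0 := by
  have hj := j.2
  have hjT := jT.2
  have hne' : (j : ℕ) ≠ jT := fun h => hne (Fin.ext h)
  have hmod : ((j : ℕ) + 1 = Lt ∧ ((nxt j : Fin Lt) : ℕ) = 0) ∨
      ((j : ℕ) + 1 < Lt ∧ ((nxt j : Fin Lt) : ℕ) = j + 1) := by
    show ((j : ℕ) + 1 = Lt ∧ ((j : ℕ) + 1) % Lt = 0) ∨ ((j : ℕ) + 1 < Lt ∧ ((j : ℕ) + 1) % Lt = j + 1)
    rcases Nat.lt_or_ge ((j : ℕ) + 1) Lt with h | h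
    · exact Or.inr ⟨h, Nat.mod_eq_of_lt h⟩
    · left
      have : (j : ℕ) + 1 = Lt := by omega
      exact ⟨this, by rw [this, Nat.mod_self]⟩
  generalize ((nxt j : Fin Lt) : ℕ) = r at hmod
  have h11 : (1 : ZMod 2) + 1 = 0 := by decide
  split_ifs <;> simp only [add_zero, zero_add, h11] <;> (exfalso; omega)

/-- **The cycle span program computes CLIQUE** (`k ≥ 2`): the target is generated by the rows of the
on-wires iff some `k`-set has all its edges on. [folklore] -/
theorem tgt_mem_closure_iff (hk : 2 ≤ k) (x : (⊤ : SimpleGraph (Fin m)).edgeSet → Bool) :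
    Multiplicative.ofAdd (tgt m k) ∈ Subgroup.closure
        ((fun w => Multiplicative.ofAdd (row m k w)) '' {w : W m k | x (wedge m k w) = true}) ↔
      ∃ T : KSub m k, ∀ e : ET m k T, x e.1 = true := by
  classical
  -- every k-set, k ≥ 2, has an edge inside it
  have hLpos : ∀ T : KSub m k, 0 < L m k T := by
    intro T
    obtain ⟨a, ha, b, hb, hab⟩ := Finset.one_lt_card.1 (by rw [T.2]; omega)
    have he : s(a, b) ∈ (⊤ : SimpleGraph (Fin m)).edgeSet := by
      rw [SimpleGraph.mem_edgeSet]; exact hab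
    refine Fintype.card_pos_iff.2 ⟨⟨⟨s(a, b), he⟩, fun y hy => ?_⟩⟩
    rcases Sym2.mem_iff.1 hy with rfl | rfl
    · exact ha
    · exact hb
  constructor
  · -- soundness: if every T has an off wire j_T, the functional φ_c kills all on-rows but not the target
    intro hmem
    by_contra hno
    push Not at hno
    have hoff : ∀ T : KSub m k, ∃ j : Fin (L m k T), x (wedge m k ⟨T, j⟩) = false := by
      intro T
      obtain ⟨e, he⟩ := hno T
      refine ⟨enumET m k T e, ?_⟩
      simpa [wedge] using he
    choose jT hjT using hoff
    let c : W m k → ZMod 2 := fun w => if 1 ≤ (w.2 : ℕ) ∧ (w.2 : ℕ) ≤ jT w.1 then 1 else 0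
    have hker : Subgroup.closure
        ((fun w => Multiplicative.ofAdd (row m k w)) '' {w : W m k | x (wedge m k w) = true}) ≤
        (AddMonoidHom.toMultiplicative (phi c)).ker := by
      rw [Subgroup.closure_le]
      rintro _ ⟨⟨T, j⟩, hw, rfl⟩
      rw [SetLike.mem_coe, MonoidHom.mem_ker]
      show Multiplicative.ofAdd (phi c (row m k ⟨T, j⟩)) = 1
      have hne : j ≠ jT T := by
        rintro rfl
        rw [Set.mem_setOf_eq, hjT T] at hw
        exact Bool.false_ne_true hw
      rw [phi_row]
      show Multiplicative.ofAdd (_ : ZMod 2) = Multiplicative.ofAdd 0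
      congr 1
      exact kill_arith j (jT T) hne
    have h1 := hker hmem
    rw [MonoidHom.mem_ker] at h1
    have h2 : phi c (tgt m k) = 0 := by
      have : Multiplicative.ofAdd (phi c (tgt m k)) = Multiplicative.ofAdd (0 : ZMod 2) := h1
      exact Multiplicative.ofAdd.injective this
    rw [tgt, phi_single_none] at h2
    exact one_ne_zero h2
  · -- completeness: the rows of a full k-set sum to the target
    rintro ⟨T, hT⟩
    rw [← sum_row_eq_tgt T (hLpos T), ofAdd_sum]
    refine Subgroup.prod_mem _ fun j _ => Subgroup.subset_closure ⟨⟨T, j⟩, ?_, rfl⟩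
    exact hT _

/-! ### 3. CLIQUE(m,k) is ONE PERM gate -/

variable (m k)

/-- Number of wires. [folklore] -/
noncomputable def nW : ℕ := Fintype.card (W m k)

/-- Enumeration of the wires. [folklore] -/
noncomputable def eW : W m k ≃ Fin (nW m k) := Fintype.equivFin _

/-- The PERM width of the construction: `2 · (1 + #wires)`. [folklore] -/
noncomputable def permWidth : ℕ := Fintype.card (ZMod 2 × Option (W m k))

/-- The clique span gate as a gate function of arity `#wires`. [folklore] -/
noncomputable def cliqueSpanGate : GateFn :=
  ⟨nW m k, fun v => @decide (Multiplicative.ofAdd (tgt m k) ∈ Subgroup.closure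
    ((fun i => Multiplicative.ofAdd (row m k ((eW m k).symm i))) '' {i | v i = true}))
      (Classical.dec _)⟩

/-- Its acceptance condition. [folklore] -/
theorem cliqueSpanGate_apply (v : Fin (nW m k) → Bool) :
    (cliqueSpanGate m k).2 v = true ↔ Multiplicative.ofAdd (tgt m k) ∈ Subgroup.closure
      ((fun i => Multiplicative.ofAdd (row m k ((eW m k).symm i))) '' {i | v i = true}) :=
  @decide_eq_true_iff _ (Classical.dec _)

/-- It is a PERM gate on `permWidth m k` points. [folklore] -/
theorem cliqueSpanGate_isPermGate : IsPermGate (permWidth m k) (cliqueSpanGate m k) :=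
  spanGate_isPermGate (fun i => row m k ((eW m k).symm i)) (tgt m k) _ (cliqueSpanGate_apply m k)

/-- **CLIQUE(m,k), k ≥ 2, is computed by a size-1 circuit whose gate is a PERM gate on `permWidth m k`
points** (wire `i` reads the edge `wedge (eW⁻¹ i)`). [folklore] -/
theorem exists_onePermGate_computes (hk : 2 ≤ k) :
    ∃ C : Circuit ((⊤ : SimpleGraph (Fin m)).edgeSet),
      C.IsOver {g | IsPermGate (permWidth m k) g} ∧ C.size ≤ 1 ∧ C.Computes (cliqueFn m k) := by
  classical
  obtain ⟨C, hC, hs, he⟩ := (CktSize.gate (B := {g | IsPermGate (permWidth m k) g})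
    (cliqueSpanGate m k) (cliqueSpanGate_isPermGate m k) (fun i => wedge m k ((eW m k).symm i))).toCircuit
  refine ⟨C, hC, hs, fun x => ?_⟩
  rw [he x, Bool.eq_iff_iff]
  show ((cliqueSpanGate m k).2 fun a => x (wedge m k ((eW m k).symm a))) = true ↔
    cliqueFn m k x = true
  have hset : (fun i => Multiplicative.ofAdd (row m k ((eW m k).symm i))) ''
      {i | x (wedge m k ((eW m k).symm i)) = true} =
      (fun w => Multiplicative.ofAdd (row m k w)) '' {w : W m k | x (wedge m k w) = true} := by
    ext g
    constructor
    · rintro ⟨i, hi, rfl⟩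
      exact ⟨(eW m k).symm i, hi, rfl⟩
    · rintro ⟨w, hw, rfl⟩
      exact ⟨eW m k w, by simpa using hw, by simp⟩
  rw [cliqueSpanGate_apply, hset, tgt_mem_closure_iff hk, CliqueLPGate.cliqueFn_eq_true_iff_exists]
  exact ⟨fun ⟨T, hT⟩ => ⟨T.1, T.2, fun e he => hT ⟨e, he⟩⟩,
    fun ⟨S, hS, hall⟩ => ⟨⟨S, hS⟩, fun e => hall e.1 e.2⟩⟩

/-- Width bookkeeping: `permWidth m k = 2 · (1 + #wires)` and `#wires ≤ C(m,k) · #E`. [folklore] -/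
theorem permWidth_le : permWidth m k ≤ 2 * (1 + m.choose k * nE m) := by
  rw [permWidth, card_zmod_two_prod, Fintype.card_option]
  refine Nat.mul_le_mul_left 2 ?_
  rw [add_comm]
  refine Nat.add_le_add_left ?_ 1
  calc Fintype.card (W m k) = ∑ T : KSub m k, Fintype.card (Fin (L m k T)) := Fintype.card_sigma
    _ = ∑ T : KSub m k, L m k T := by simp only [Fintype.card_fin]
    _ ≤ ∑ _T : KSub m k, nE m := Finset.sum_le_sum fun T _ =>
        Fintype.card_le_of_injective (fun e : ET m k T => e.1) Subtype.val_injective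
    _ = m.choose k * nE m := by rw [Finset.sum_const, Finset.card_univ, smul_eq_mul, ← nK, nK_eq]

/-- `permWidth m k ≤ m^{j+3}` once `C(m,k) ≤ m^j` and `m ≥ 3`. [folklore] -/
theorem permWidth_le_of_choose_le (j : ℕ) (hm : 3 ≤ m) (hq : m.choose k ≤ m ^ j) :
    permWidth m k ≤ m ^ (j + 3) := by
  have h1 : 1 ≤ m := by omega
  refine (permWidth_le m k).trans ?_
  have hn : nE m ≤ m ^ 2 := nE_le m
  have hmul : m.choose k * nE m ≤ m ^ (j + 2) := by
    calc m.choose k * nE m ≤ m ^ j * m ^ 2 := Nat.mul_le_mul hq hn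
      _ = m ^ (j + 2) := by ring
  have htwo : 2 ≤ m ^ (j + 2) := le_trans (by omega) (Nat.le_self_pow (by omega) m)
  calc 2 * (1 + m.choose k * nE m) ≤ 3 * m ^ (j + 2) := by omega
    _ ≤ m * m ^ (j + 2) := Nat.mul_le_mul_right _ hm
    _ = m ^ (j + 3) := by ring

/-- As a `B_s`-circuit for `s ≥ permWidth m k`. [folklore] -/
theorem exists_onePermGate_extGate_computes (hk : 2 ≤ k) {s : ℕ} (hs : permWidth m k ≤ s) :
    ∃ C : Circuit ((⊤ : SimpleGraph (Fin m)).edgeSet),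
      C.IsOver ({GateFn.and 2, GateFn.or 2} ∪ {g | IsPermGate s g}) ∧ C.size ≤ 1 ∧
        C.Computes (cliqueFn m k) := by
  obtain ⟨C, hC, h1, hc⟩ := exists_onePermGate_computes m k hk
  exact ⟨C, hC.mono fun g hg => Or.inr (IsPermGate.mono hg hs), h1, hc⟩

end CliqueSpan

end Summit.PneNP.PneNP.Theorems.CliqueExtLowerBound.Negative
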